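import Summits.HodgeConjecture.HodgeConjecture.Theorems.Ring2AtlasWeilCarriers
import Summits.HodgeConjecture.HodgeConjecture.Theorems.Ring2HypothesesAtlasSixfolds
import Summits.HodgeConjecture.HodgeConjecture.Theorems.PadicSemiregularLiftHodgeAbelianVarietiesEStepDefs
import Literature.AlgebraicGeometry.HodgeTheory.WeilClassesEllipticExchange
import Literature.AlgebraicGeometry.HodgeTheory.WeilClassesFourfolds
import Literature.AlgebraicGeometry.HodgeTheory.RibetTypeHodgeClasses
import Literature.AlgebraicGeometry.HodgeTheory.DegreeOneHodgeTypes
import Literature.AlgebraicGeometry.HodgeTheory.AbelianVarietyEndomorphismsHOne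
import Literature.NumberTheory.EllipticCurves.CMEndomorphismOfMulMemLattice
import HarnessLib

/-!
# Ring 2 · atlas-2 (generation 11) — the Weil-type CARRIER tenfolds `Y₄ × Z₃²` PRICED by the elliptic exchange

HONEST FRAMING: research route conditional on HC_CM; not a corollary; Q11.4-sentence-2 already refuted in dim ≥ 3.

Cell `pub-hodge-ring2`, seat `pub-hodge-ring2-atlas-2` (generation 11). Companion of `Ring2AtlasWeilCarriers`
(generation 10: the typed carrier cells `HodgeQuarticFieldFourfoldCMThreefoldSquaredCarrier`,
`HodgeQuadraticFourfold31CMThreefoldSquaredCarrier`) and of the write-ups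
`run/shared/lean/pub/pub-hodge-ring2/pub-hodge-ring2-atlas-2-g10/RELCHAR.md` (§5: the codimension-5 exceptional
classes of `(Y₄ × Z₃)²` are pull-backs of the two Weil lines of the `(5,5)` Weil-type tenfold `T = Y₄ × Z₃ × Z₃`)
and `…/pub-hodge-ring2-atlas-2-g11/ERRATA-G11.md` (§3, §5). `HC_CM` = the binder `Theses.RankFourFaces.CMAbelianHodge`
(hypothesis by name only; it does NOT occur in this file); `HC_AV` = `Theses.PadicSemiregularLift.HodgeAbelianVarieties`.

## What this file does

Generation 10 typed the carrier cells and recorded "PRINT STATUS: OPEN — Weil classes on Weil-type TENFOLDS are not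
known in print". The motivic seat's Literature layer `WeilClassesEllipticExchange` (p205343) shows that the
tenfold `T = Y × Z × Z` (`dim Y = 4`, `dim Z = 3`, `K = ℚ(√-d)` acting diagonally) needs NO tenfold input: after
padding with a CM curve `E₀` and exchanging the elliptic factors, the rational `(5,5)` Weil classes of `T` are
algebraic as soon as the Weil planes of the two COMPLETIONS `F_Y = Y × E₀ × E₀` (a sixfold, level 3) and
`F_Z = Z × E₀` (a fourfold, level 2) consist of algebraic classes. This file turns that into KERNEL ROWS for the
two carrier cells:

* §1 (unconditional bookkeeping) `eigenMultiplicity_prodLift`, `eigenMultiplicity_neg`: the multiplicity of the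
  eigenvalue `i√d` on `H^{1,0}` is additive over products and flips under `φ ↦ -φ`.
* §2 (unconditional) `exists_balanced_ellipticCompletions`: if `(T, ψ × χ × χ)` is of Weil type `(5,5)` then for a
  suitable SIGN of the CM structure `ψ₀` on the padding curve `E₀` (which exists: `exists_cmCurve_sqrt_neg`) BOTH
  completions are of Weil type — `(F_Z, χ × ψ₀)` of type `(2,2)` and `(F_Y, ψ × (-ψ₀) × (-ψ₀))` of type `(3,3)`.
  (Arithmetic of multiplicities: `m_Y + 2 m_Z = 5`, `m_Y ≤ 4`, `m_Z ≤ 3` force `(m_Y, m_Z) ∈ {(3,1), (1,2)}`.)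
  This is exactly what makes the exchange's slice hypotheses SATISFIABLE from statements about Weil-type
  varieties (on an unbalanced completion the Weil plane is not of Hodge type and nothing is known or needed).
* §3 (unconditional reduction) `hodgeConjectureFor_prod_prod_of_weilGenerated_of_slices`: for ONE such `T`,
  `HC(T) ⟸ [T of Weil type (5,5)] + [(G_T): the Hodge ring of T is generated by divisor classes and the Weil
  plane, `IsDivisorWeilGenerated`] + [Weil classes algebraic on every Weil-type SIXFOLD for ℚ(√-d)] + [the same on
  every Weil-type FOURFOLD for ℚ(√-d)]` — by `hodgeConjectureFor_of_isDivisorWeilGenerated` (Ring 2,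
  `WeilTypeHodgeRing`), the tree's unconditional `D• ⊆ algebraic` (`divisorClassesSpan_le_algebraicClasses_holds`),
  §2 and the elliptic exchange.
* §4 (cell rows, hypotheses-layer style of `Ring2HypothesesAtlasSixfolds` §4) the two carrier cells follow from
  a TYPED CELL HYPOTHESIS `(S+G)_T` (below) plus the two slice inputs; by-name corollaries take the slice inputs
  from the route item `W₆ = Theses.SevenfoldWeilCensus.WeilSixfolds` (stmt-HodgeConjecture-2524, rung R1 of
  `WeilTypeLadder`) and from the named Literature fact `Markman2025_weilClasses_algebraic_abelianFourfold` (F1), or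
  from the E-step ladder names `WeilAlgebraicAll 3 d`, `WeilAlgebraicAll 2 d`.

## The typed cell hypothesis `(S+G)_T` — CELL INFERENCE, entered as an argument, never asserted

For every member `(Y, Z, ψ, χ, d)` of the cell: there is a `K`-structure `χ'` on `Z` with `χ' ≫ χ' = -d` (namely
`χ' = ± χ`) such that `(T, ψ × χ' × χ')` is of Weil type `(5,5)` — the SIGN part `(S)`: `K ⊂ M = End⁰(Y)` acts on
`H^{1,0}(Y)` with multiplicities `(3,1)` or `(1,3)` (never `(2,2)`: Shimura 1963 Prop. 14 / Moonen–Zarhin 1999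
(2.5)(2), the type-IV(2,1) signature; for the second cell it is a binder) and `K ⊂ F' = End⁰(Z)` with `(2,1)` or
`(1,2)` (a simple CM threefold has primitive CM type) — and such that the Hodge ring of `T` is generated by divisor
classes off the middle degree and by divisor classes plus the Weil plane in degree 10 — the GENERATION part `(G)`.
`(G)` is a Hodge-THEORETIC statement (not a case of the summit); on the cell's Mumford–Tate model it is CERTIFIED by
two independent engines (RELCHAR §3–§5, engine A = engine B on every block; carrier rows
`data/atlas/relchar/relchar_A_carriers_k1.json`: `b•(Y₄/M × Z₃²) = (1,14,78,228,405,494,405,228,78,14,1)` against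
`d• = (…,492,…)`, i.e. `B^p = D^p` for `p ≠ 5` and `dim B⁵/D⁵ = 2` = the two Weil lines; `(1,13,64,152,203,216,…)`
against `214` for the `(3,1)`-quadratic cell), and ERRATA-G11 §5 records why the model does not depend on the
Galois configuration of `M · F'` (relation lattice of rank 1 in all three configurations). It is NOT kernel-proved
and NOT in print for these tenfolds; the rows below carry it as a HYPOTHESIS on members, exactly as
`Ring2HypothesesAtlasSixfolds` carries `(G)` for the sixfold rows.

## Print status (numbers, not adjectives)

With `(S+G)_T` granted, the carrier cells cost `W₆(d)` on the split sixfolds `Y₄ × E₀²` and F1`(d)` on the fourfolds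
`Z₃ × E₀`: NO statement about tenfolds. Refereed print decides `W₆(d)`-on-hyperbolic-sixfolds for `K = ℚ(i)` (Koike
2004, the tree's `Koike2004_weilClasses_algebraic_hyperbolicSixfold_one`) and `K = ℚ(√-3)` (Schoen 1998,
`Schoen1998_weilClasses_algebraic_hyperbolicSixfold_three`); Markman arXiv:2502.03415 Thm. 1.5.1 (UNREFEREED) covers
discriminant `-1` sixfolds for all `K`; whether the product polarisations of `Y₄ × E₀²` are hyperbolic is DERIVED in
ERRATA-G11 §1 (yes: the curve factors rescale the discriminant class at will) and is NOT a kernel claim of this file.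
Sources: [cite: Schoen1998HodgeWeilAddendum, §10] [cite: Deligne1982HodgeCycles, §4 Prop. 4.4, §5 (c)]
[cite: MoonenZarhin1999LowDim, §2 (2.5)(2), §5 Case 2] [cite: MoonenZarhin1998WeilClasses, p. 2 and Criterion (4.1)]
[cite: vanGeemen1994HodgeAV, §2.4, 5.2, Thm. 6.12] [cite: Markman2025SecantWeil, Thm. 1.5.1]
[cite: Koike2004WeilHodge, Thm. 2.1] [cite: LangeBirkenhake1992, §1.1]
-/

open CategoryTheory

namespace Summit.HodgeConjecture.HodgeConjecture.Ring2.Atlas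

open Literature.AlgebraicGeometry Literature.AlgebraicGeometry.Motives
open Literature.AlgebraicGeometry.HodgeTheory
open Literature.AlgebraicTopology.SingularHomology
open Literature.Barriers.HodgeConjecture (divisorClassesSpan)
open Summit.HodgeConjecture.HodgeConjecture.Theses
open Summit.HodgeConjecture.HodgeConjecture.Ring2.Hypotheses
open Summit.HodgeConjecture.HodgeConjecture.Theorems.HodgeAbelianVarieties.Unconditional
open Summit.HodgeConjecture.HodgeConjecture.Cruxes.HodgeAbelianVarieties.EStepSecantInduction
  (WeilAlgebraicFor WeilAlgebraicAll)

/-! ## §1 Multiplicity bookkeeping (unconditional) -/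

section Multiplicity

variable {A B : AbelianVariety ℂ}

/-- **Additivity of the `H^{1,0}`-multiplicity over products**: for the product structure
`φ × ψ = prodLift (fst ≫ φ) (snd ≫ ψ)` on `A × B`, the multiplicity of any eigenvalue `μ` on `H^{1,0}(A × B)` is the
sum of the multiplicities on the factors (Künneth in degree one, `finrank_eigenspace_inf_hodgeOneZero_prod`).
[cite: LangeBirkenhake1992, §1.1 (p. 19)] [cite: MoonenZarhin1998WeilClasses, §1 (the multiplicities n_σ)] -/
theorem eigenMultiplicity_prodLift (φ : A ⟶ A) (ψ : B ⟶ B) (μ : ℂ) :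
    eigenMultiplicity (A.prod B)
        (AbelianVariety.prodLift (AbelianVariety.fst A B ≫ φ) (AbelianVariety.snd A B ≫ ψ)) μ =
      eigenMultiplicity A φ μ + eigenMultiplicity B ψ μ := by
  have h := finrank_eigenspace_inf_hodgeOneZero_prod (A := A) (B := B) rfl rfl φ ψ μ
  unfold eigenMultiplicity
  rw [← Deligne1982.hodgeOneZero_eq_of_dim_eq (A := A.prod B) (AbelianVariety.dim_prod A B)
    (isSmoothProjective_of_dim_eq' (AbelianVariety.dim_prod A B))
    (AbelianVariety.isSmoothProjective_holds (A := A.prod B))]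
  exact h

/-- **The multiplicity flips under `φ ↦ -φ`**: `(-φ)^* = -φ^*` on `H¹` (`complexBetti_map_neg_one`), so the
`μ`-eigenspace of `-φ` is the `(-μ)`-eigenspace of `φ`. [cite: LangeBirkenhake1992, §1.1 (p. 19)] -/
theorem eigenMultiplicity_neg (φ : A ⟶ A) (μ : ℂ) :
    eigenMultiplicity A (-φ) μ = eigenMultiplicity A φ (-μ) := by
  have hE : Module.End.eigenspace (complexBetti.map (-φ).hom.hom.hom 1).hom μ =
      Module.End.eigenspace (complexBetti.map φ.hom.hom.hom 1).hom (-μ) := by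
    rw [complexBetti_map_neg_one]
    ext x
    rw [Module.End.mem_eigenspace_iff, Module.End.mem_eigenspace_iff, ModuleCat.hom_neg,
      LinearMap.neg_apply, neg_smul]
    exact neg_eq_iff_eq_neg
  unfold eigenMultiplicity
  rw [hE]

end Multiplicity

/-! ## §2 Balanced elliptic completions of the tenfold `Y × Z × Z` (unconditional) -/

section Carrier

variable {Y Z : AbelianVariety ℂ} {d : ℕ} {ψ : Y ⟶ Y} {χ : Z ⟶ Z}

/-- **Balanced completions.** Let `K = ℚ(√-d)` act by `ψ` on `Y` (`dim 4`) and by `χ` on `Z` (`dim 3`), and suppose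
the diagonal structure `ψ × χ × χ` makes `T = Y × Z × Z` of Weil type `(5,5)`. Then there is a CM curve
`(E₀, ψ₀)`, `ψ₀² = -d`, such that `(Z × E₀, χ × ψ₀)` is of Weil type `(2,2)` AND `(Y × E₀ × E₀, ψ × (-ψ₀) × (-ψ₀))`
is of Weil type `(3,3)`. Proof: multiplicities of `i√d` on `H^{1,0}` add over products (§1) and `m(φ) + m(-φ… )`-type
sums equal the dimension (`eigenMultiplicity_add_eigenMultiplicity_neg_eq_dim`); `m_Y + 2 m_Z = 5` with `m_Y ≤ 4`
forces `(m_Y, m_Z) ∈ {(3,1), (1,2)}`, and the curve of `exists_cmCurve_sqrt_neg` is used with `ψ₀` or `-ψ₀`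
according as `m_Z + m(ψ₀) = 2` or not. [cite: Deligne1982HodgeCycles, §5 (c) and (4.8)]
[cite: MoonenZarhin1998WeilClasses, p. 2] [cite: Schoen1998HodgeWeilAddendum, §10] -/
theorem exists_balanced_ellipticCompletions (hd : 0 < d) (hY : Y.dim = 4) (hZ : Z.dim = 3)
    (hψ : ψ ≫ ψ = -(d • 𝟙 Y)) (hχ : χ ≫ χ = -(d • 𝟙 Z))
    (hT : IsWeilType (Y.prod (Z.prod Z))
      (AbelianVariety.prodLift (AbelianVariety.fst Y (Z.prod Z) ≫ ψ)
        (AbelianVariety.snd Y (Z.prod Z) ≫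
          AbelianVariety.prodLift (AbelianVariety.fst Z Z ≫ χ) (AbelianVariety.snd Z Z ≫ χ))) 5 d) :
    ∃ (E₀ : AbelianVariety ℂ) (ψ₀ : E₀ ⟶ E₀), E₀.dim = 1 ∧ ψ₀ ≫ ψ₀ = -(d • 𝟙 E₀) ∧
      IsWeilType (Z.prod E₀)
        (AbelianVariety.prodLift (AbelianVariety.fst Z E₀ ≫ χ) (AbelianVariety.snd Z E₀ ≫ ψ₀)) 2 d ∧
      IsWeilType (Y.prod (E₀.prod E₀))
        (AbelianVariety.prodLift (AbelianVariety.fst Y (E₀.prod E₀) ≫ ψ)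
          (AbelianVariety.snd Y (E₀.prod E₀) ≫
            AbelianVariety.prodLift (AbelianVariety.fst E₀ E₀ ≫ (-ψ₀))
              (AbelianVariety.snd E₀ E₀ ≫ (-ψ₀)))) 3 d := by
  -- multiplicities of `i√d` on `H^{1,0}`
  have hmT := eigenMultiplicity_eq_of_isWeilType hT
  rw [eigenMultiplicity_prodLift, eigenMultiplicity_prodLift] at hmT
  have hmY := eigenMultiplicity_add_eigenMultiplicity_neg_eq_dim Y ψ hd hψ
  have hmZ := eigenMultiplicity_add_eigenMultiplicity_neg_eq_dim Z χ hd hχ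
  rw [hY] at hmY
  rw [hZ] at hmZ
  obtain ⟨E₀, ψ₀, hE, hψ₀⟩ :=
    Literature.NumberTheory.EllipticCurves.CMEndomorphism.exists_cmCurve_sqrt_neg d hd
  have hm₀ := eigenMultiplicity_add_eigenMultiplicity_neg_eq_dim E₀ ψ₀ hd hψ₀
  rw [hE] at hm₀
  have hnψ₀ : (-ψ₀) ≫ (-ψ₀) = -(d • 𝟙 E₀) := by
    rw [Preadditive.neg_comp, Preadditive.comp_neg, neg_neg, hψ₀]
  have hZE : (Z.prod E₀).dim = 2 * 2 := by rw [AbelianVariety.dim_prod, hZ, hE]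
  have hYEE : (Y.prod (E₀.prod E₀)).dim = 2 * 3 := by
    rw [AbelianVariety.dim_prod, AbelianVariety.dim_prod, hY, hE]
  by_cases hc : eigenMultiplicity Z χ (Complex.I * (Real.sqrt d : ℂ)) +
      eigenMultiplicity E₀ ψ₀ (Complex.I * (Real.sqrt d : ℂ)) = 2
  · refine ⟨E₀, ψ₀, hE, hψ₀, ?_, ?_⟩
    · refine isWeilType_of_eigenMultiplicity_eq (by norm_num) hd hZE
        (prodLift_comp_self_eq_neg_nsmul hχ hψ₀) ?_
      rw [eigenMultiplicity_prodLift]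
      exact hc
    · refine isWeilType_of_eigenMultiplicity_eq (by norm_num) hd hYEE
        (prodLift_comp_self_eq_neg_nsmul hψ (prodLift_comp_self_eq_neg_nsmul hnψ₀ hnψ₀)) ?_
      rw [eigenMultiplicity_prodLift, eigenMultiplicity_prodLift, eigenMultiplicity_neg]
      omega
  · refine ⟨E₀, -ψ₀, hE, hnψ₀, ?_, ?_⟩
    · refine isWeilType_of_eigenMultiplicity_eq (by norm_num) hd hZE
        (prodLift_comp_self_eq_neg_nsmul hχ hnψ₀) ?_
      rw [eigenMultiplicity_prodLift, eigenMultiplicity_neg]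
      omega
    · rw [neg_neg]
      refine isWeilType_of_eigenMultiplicity_eq (by norm_num) hd hYEE
        (prodLift_comp_self_eq_neg_nsmul hψ (prodLift_comp_self_eq_neg_nsmul hψ₀ hψ₀)) ?_
      rw [eigenMultiplicity_prodLift, eigenMultiplicity_prodLift]
      omega

/-! ## §3 The reduction for one tenfold (unconditional) -/

/-- **HC for the tenfold `T = Y × Z × Z` from generation + two slices.** If `(T, ψ × χ × χ)` is of Weil type `(5,5)`
for `K = ℚ(√-d)`, its Hodge ring is generated by divisor classes and the Weil plane (`IsDivisorWeilGenerated`), and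
for this `d` the Weil classes are algebraic on every Weil-type SIXFOLD and on every Weil-type FOURFOLD, then
`HC(T)`. Composition of: `hodgeConjectureFor_of_isDivisorWeilGenerated` (Ring 2 hypotheses layer), the tree's
unconditional `D• ⊆ algebraic` (`divisorClassesSpan_le_algebraicClasses_holds`: Lefschetz (1,1) and cup products),
§2, and the motivic seat's ELLIPTIC EXCHANGE `weilClasses_ellipticExchange_four_three_three` fed with the slice
inputs on the balanced completions. [cite: Schoen1998HodgeWeilAddendum, §10 (Proposition and proof)]
[cite: Deligne1982HodgeCycles, §5 (c)] [cite: vanGeemen1994HodgeAV, §2.4 and Thm. 6.12] -/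
theorem hodgeConjectureFor_prod_prod_of_weilGenerated_of_slices (hd : 0 < d) (hY : Y.dim = 4) (hZ : Z.dim = 3)
    (hψ : ψ ≫ ψ = -(d • 𝟙 Y)) (hχ : χ ≫ χ = -(d • 𝟙 Z))
    (hT : IsWeilType (Y.prod (Z.prod Z))
      (AbelianVariety.prodLift (AbelianVariety.fst Y (Z.prod Z) ≫ ψ)
        (AbelianVariety.snd Y (Z.prod Z) ≫
          AbelianVariety.prodLift (AbelianVariety.fst Z Z ≫ χ) (AbelianVariety.snd Z Z ≫ χ))) 5 d)
    (hG : IsDivisorWeilGenerated (Y.prod (Z.prod Z))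
      (AbelianVariety.prodLift (AbelianVariety.fst Y (Z.prod Z) ≫ ψ)
        (AbelianVariety.snd Y (Z.prod Z) ≫
          AbelianVariety.prodLift (AbelianVariety.fst Z Z ≫ χ) (AbelianVariety.snd Z Z ≫ χ))) 5 d)
    (h₃ : ∀ (A : AbelianVariety ℂ) (φ : A ⟶ A), IsWeilType A φ 3 d → WeilAlgebraicFor 3 d A φ)
    (h₂ : ∀ (A : AbelianVariety ℂ) (φ : A ⟶ A), IsWeilType A φ 2 d → WeilAlgebraicFor 2 d A φ) :
    HodgeConjectureFor (Y.prod (Z.prod Z)).dim (Y.prod (Z.prod Z)).X := by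
  obtain ⟨E₀, ψ₀, hE, hψ₀, hFZ, hFY⟩ := exists_balanced_ellipticCompletions hd hY hZ hψ hχ hT
  exact hodgeConjectureFor_of_isDivisorWeilGenerated hT hG
    (fun p ↦ divisorClassesSpan_le_algebraicClasses_holds _ p)
    (fun c hcW hc hH ↦ weilClasses_ellipticExchange_four_three_three hd hY hZ hE hψ hχ hψ₀
      (hFY.weilClassesOf_le_algebraicClasses (h₃ _ _ hFY))
      (hFZ.weilClassesOf_le_algebraicClasses (h₂ _ _ hFZ)) c hc hH hcW)

/-! ### The slice inputs by name -/

/-- The level-`n` slice from the E-step ladder name `WeilAlgebraicAll n d`. [cite: vanGeemen1994HodgeAV, §5.2] -/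
theorem weilAlgebraicFor_of_weilAlgebraicAll {n : ℕ} {A : AbelianVariety ℂ} {φ : A ⟶ A}
    (h : WeilAlgebraicAll n d) (hW : IsWeilType A φ n d) : WeilAlgebraicFor n d A φ :=
  h A φ hW.dim_eq hW.sq_eq

/-- The level-3 slice from the route item `W₆ = Theses.SevenfoldWeilCensus.WeilSixfolds` (stmt-HodgeConjecture-2524;
on path: `WeilTypeLadder.weilSixfolds_iff_weilClassesOf`). [cite: Deligne1982HodgeCycles, §4 Prop. 4.4]
[cite: Markman2025SecantWeil, Thm. 1.5.1] -/
theorem weilAlgebraicFor_three_of_weilSixfolds (hW₆ : SevenfoldWeilCensus.WeilSixfolds) {A : AbelianVariety ℂ}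
    {φ : A ⟶ A} (hW : IsWeilType A φ 3 d) : WeilAlgebraicFor 3 d A φ :=
  weilClasses_algebraic_of_weilSixfolds hW₆ A (by have := hW.dim_eq; omega) 3 d φ hW

/-- The level-2 slice from the named Literature fact F1 `Markman2025_weilClasses_algebraic_abelianFourfold` (Weil
classes on abelian FOURFOLDS of Weil type; source UNREFEREED as recorded in `WeilClassesFourfolds`).
[cite: Markman2025SurveySecant, Thm. 1.2 and §11.5 Step 2] [cite: Markman2025SecantWeil, Cor. 1.6.1 (proof)] -/
theorem weilAlgebraicFor_two_of_markmanFourfold (hF1 : Markman2025_weilClasses_algebraic_abelianFourfold)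
    {A : AbelianVariety ℂ} {φ : A ⟶ A} (hW : IsWeilType A φ 2 d) : WeilAlgebraicFor 2 d A φ :=
  fun c hcW hc hH ↦ hF1 d hW.d_pos A φ hW.dim_eq hW.isSmoothProjective hW.sq_eq c hc hH hcW

end Carrier

/-! ## §4 The carrier cells (hypotheses-layer rows) -/

/-- **CELL ROW — `HodgeQuarticFieldFourfoldCMThreefoldSquaredCarrier` (the tenfolds `Y₄/M × Z₃²`) from the typed
cell hypothesis `(S+G)_T` and the two slice inputs.** `hSG` (CELL INFERENCE, engine-certified on the cell's
Mumford–Tate model — RELCHAR §5, carrier row `T10.Y4_MxZ3sq/k`: `b⁵ = 494 = d⁵ + 2`, `b^p = d^p` off `p = 5`; not in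
print; entered as an argument, never asserted): for every member there is a `K`-structure `χ'` on `Z` (`= ±χ`) making
`(T, ψ × χ' × χ')` of Weil type `(5,5)` with Hodge ring generated by divisors and the Weil plane. `h₃`/`h₂`: Weil
classes algebraic on Weil-type sixfolds / fourfolds for every `ℚ(√-d)`. KIND of `HC_CM`: ABSENT.
[cite: MoonenZarhin1999LowDim, §2 (2.5)(2) and §5 Case 2] [cite: Schoen1998HodgeWeilAddendum, §10]
[cite: Deligne1982HodgeCycles, §5 (c)] -/
theorem hodgeQuarticFieldFourfoldCMThreefoldSquaredCarrier_of_weilGenerated_of_slices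
    (hSG : ∀ (Y Z : AbelianVariety ℂ) (ψ : Y ⟶ Y) (χ : Z ⟶ Z) (d : ℕ), 0 < d → IsQuarticFieldTypeIVFourfold Y →
      Z.dim = 3 → Z.IsSimple → IsField Z.endAlgebra → Module.finrank ℚ Z.endAlgebra = 6 →
      ψ ≫ ψ = -(d • 𝟙 Y) → χ ≫ χ = -(d • 𝟙 Z) →
      ∃ χ' : Z ⟶ Z, χ' ≫ χ' = -(d • 𝟙 Z) ∧
        IsWeilType (Y.prod (Z.prod Z))
          (AbelianVariety.prodLift (AbelianVariety.fst Y (Z.prod Z) ≫ ψ)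
            (AbelianVariety.snd Y (Z.prod Z) ≫
              AbelianVariety.prodLift (AbelianVariety.fst Z Z ≫ χ') (AbelianVariety.snd Z Z ≫ χ'))) 5 d ∧
        IsDivisorWeilGenerated (Y.prod (Z.prod Z))
          (AbelianVariety.prodLift (AbelianVariety.fst Y (Z.prod Z) ≫ ψ)
            (AbelianVariety.snd Y (Z.prod Z) ≫
              AbelianVariety.prodLift (AbelianVariety.fst Z Z ≫ χ') (AbelianVariety.snd Z Z ≫ χ'))) 5 d)
    (h₃ : ∀ (d : ℕ) (A : AbelianVariety ℂ) (φ : A ⟶ A), IsWeilType A φ 3 d → WeilAlgebraicFor 3 d A φ)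
    (h₂ : ∀ (d : ℕ) (A : AbelianVariety ℂ) (φ : A ⟶ A), IsWeilType A φ 2 d → WeilAlgebraicFor 2 d A φ) :
    HodgeQuarticFieldFourfoldCMThreefoldSquaredCarrier := by
  intro Y Z ψ χ d hd hY hZ hZs hZf hZ6 hψ hχ
  obtain ⟨χ', hχ', hT, hG⟩ := hSG Y Z ψ χ d hd hY hZ hZs hZf hZ6 hψ hχ
  exact hodgeConjectureFor_prod_prod_of_weilGenerated_of_slices hd hY.1 hZ hψ hχ' hT hG (h₃ d) (h₂ d)

/-- **By name: the `Y₄/M × Z₃²` carrier cell from `(S+G)_T`, the route item `W₆` (stmt-HodgeConjecture-2524) and the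
Literature fact F1 (`Markman2025_weilClasses_algebraic_abelianFourfold`).** No tenfold input, no `HC_CM`.
[cite: Deligne1982HodgeCycles, §4 Prop. 4.4 and §5 (c)] [cite: Markman2025SurveySecant, Thm. 1.2]
[cite: Schoen1998HodgeWeilAddendum, §10] -/
theorem hodgeQuarticFieldFourfoldCMThreefoldSquaredCarrier_of_weilGenerated_of_weilSixfolds_of_markmanFourfold
    (hSG : ∀ (Y Z : AbelianVariety ℂ) (ψ : Y ⟶ Y) (χ : Z ⟶ Z) (d : ℕ), 0 < d → IsQuarticFieldTypeIVFourfold Y →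
      Z.dim = 3 → Z.IsSimple → IsField Z.endAlgebra → Module.finrank ℚ Z.endAlgebra = 6 →
      ψ ≫ ψ = -(d • 𝟙 Y) → χ ≫ χ = -(d • 𝟙 Z) →
      ∃ χ' : Z ⟶ Z, χ' ≫ χ' = -(d • 𝟙 Z) ∧
        IsWeilType (Y.prod (Z.prod Z))
          (AbelianVariety.prodLift (AbelianVariety.fst Y (Z.prod Z) ≫ ψ)
            (AbelianVariety.snd Y (Z.prod Z) ≫
              AbelianVariety.prodLift (AbelianVariety.fst Z Z ≫ χ') (AbelianVariety.snd Z Z ≫ χ'))) 5 d ∧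
        IsDivisorWeilGenerated (Y.prod (Z.prod Z))
          (AbelianVariety.prodLift (AbelianVariety.fst Y (Z.prod Z) ≫ ψ)
            (AbelianVariety.snd Y (Z.prod Z) ≫
              AbelianVariety.prodLift (AbelianVariety.fst Z Z ≫ χ') (AbelianVariety.snd Z Z ≫ χ'))) 5 d)
    (hW₆ : SevenfoldWeilCensus.WeilSixfolds) (hF1 : Markman2025_weilClasses_algebraic_abelianFourfold) :
    HodgeQuarticFieldFourfoldCMThreefoldSquaredCarrier :=
  hodgeQuarticFieldFourfoldCMThreefoldSquaredCarrier_of_weilGenerated_of_slices hSG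
    (fun _ _ _ hW ↦ weilAlgebraicFor_three_of_weilSixfolds hW₆ hW)
    (fun _ _ _ hW ↦ weilAlgebraicFor_two_of_markmanFourfold hF1 hW)

/-- **By name: the `Y₄/M × Z₃²` carrier cell from `(S+G)_T` and the E-step ladder cells `WeilAlgebraicAll 3 d`,
`WeilAlgebraicAll 2 d` (all `d ≥ 1`).** [cite: vanGeemen1994HodgeAV, §5.2] [cite: Schoen1998HodgeWeilAddendum, §10] -/
theorem hodgeQuarticFieldFourfoldCMThreefoldSquaredCarrier_of_weilGenerated_of_weilAlgebraicAll
    (hSG : ∀ (Y Z : AbelianVariety ℂ) (ψ : Y ⟶ Y) (χ : Z ⟶ Z) (d : ℕ), 0 < d → IsQuarticFieldTypeIVFourfold Y →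
      Z.dim = 3 → Z.IsSimple → IsField Z.endAlgebra → Module.finrank ℚ Z.endAlgebra = 6 →
      ψ ≫ ψ = -(d • 𝟙 Y) → χ ≫ χ = -(d • 𝟙 Z) →
      ∃ χ' : Z ⟶ Z, χ' ≫ χ' = -(d • 𝟙 Z) ∧
        IsWeilType (Y.prod (Z.prod Z))
          (AbelianVariety.prodLift (AbelianVariety.fst Y (Z.prod Z) ≫ ψ)
            (AbelianVariety.snd Y (Z.prod Z) ≫
              AbelianVariety.prodLift (AbelianVariety.fst Z Z ≫ χ') (AbelianVariety.snd Z Z ≫ χ'))) 5 d ∧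
        IsDivisorWeilGenerated (Y.prod (Z.prod Z))
          (AbelianVariety.prodLift (AbelianVariety.fst Y (Z.prod Z) ≫ ψ)
            (AbelianVariety.snd Y (Z.prod Z) ≫
              AbelianVariety.prodLift (AbelianVariety.fst Z Z ≫ χ') (AbelianVariety.snd Z Z ≫ χ'))) 5 d)
    (hR : ∀ d : ℕ, 0 < d → WeilAlgebraicAll 3 d ∧ WeilAlgebraicAll 2 d) :
    HodgeQuarticFieldFourfoldCMThreefoldSquaredCarrier :=
  hodgeQuarticFieldFourfoldCMThreefoldSquaredCarrier_of_weilGenerated_of_slices hSG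
    (fun _ _ _ hW ↦ weilAlgebraicFor_of_weilAlgebraicAll (hR _ hW.d_pos).1 hW)
    (fun _ _ _ hW ↦ weilAlgebraicFor_of_weilAlgebraicAll (hR _ hW.d_pos).2 hW)

/-- **CELL ROW — `HodgeQuadraticFourfold31CMThreefoldSquaredCarrier` (the tenfolds `Y₄(3,1) × Z₃²`) from the typed
cell hypothesis `(S+G)_T` and the two slice inputs.** Here the `(3,1)` signature of `K` on `Y` is a BINDER of the
cell; `hSG` (CELL INFERENCE, engine-certified: carrier row `T10.Y4xZ3sq/k.(3,1)`, `b⁵ = 216 = d⁵ + 2`, `b^p = d^p`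
off `p = 5`; entered as an argument, never asserted) supplies the sign of the structure on `Z` and the generation.
KIND of `HC_CM`: ABSENT. [cite: MoonenZarhin1998WeilClasses, Criterion (4.1)] [cite: Schoen1998HodgeWeilAddendum, §10]
[cite: Deligne1982HodgeCycles, §5 (c)] -/
theorem hodgeQuadraticFourfold31CMThreefoldSquaredCarrier_of_weilGenerated_of_slices
    (hSG : ∀ (Y Z : AbelianVariety ℂ) (ψ : Y ⟶ Y) (χ : Z ⟶ Z) (d : ℕ), 0 < d →
      Y.dim = 4 → Y.IsSimple → Module.finrank ℚ Y.endAlgebra = 2 →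
      Z.dim = 3 → Z.IsSimple → IsField Z.endAlgebra → Module.finrank ℚ Z.endAlgebra = 6 →
      ψ ≫ ψ = -(d • 𝟙 Y) → χ ≫ χ = -(d • 𝟙 Z) →
      (eigenMultiplicity Y ψ (Complex.I * (Real.sqrt d : ℂ)) = 1 ∨
        eigenMultiplicity Y ψ (-(Complex.I * (Real.sqrt d : ℂ))) = 1) →
      ∃ χ' : Z ⟶ Z, χ' ≫ χ' = -(d • 𝟙 Z) ∧
        IsWeilType (Y.prod (Z.prod Z))
          (AbelianVariety.prodLift (AbelianVariety.fst Y (Z.prod Z) ≫ ψ)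
            (AbelianVariety.snd Y (Z.prod Z) ≫
              AbelianVariety.prodLift (AbelianVariety.fst Z Z ≫ χ') (AbelianVariety.snd Z Z ≫ χ'))) 5 d ∧
        IsDivisorWeilGenerated (Y.prod (Z.prod Z))
          (AbelianVariety.prodLift (AbelianVariety.fst Y (Z.prod Z) ≫ ψ)
            (AbelianVariety.snd Y (Z.prod Z) ≫
              AbelianVariety.prodLift (AbelianVariety.fst Z Z ≫ χ') (AbelianVariety.snd Z Z ≫ χ'))) 5 d)
    (h₃ : ∀ (d : ℕ) (A : AbelianVariety ℂ) (φ : A ⟶ A), IsWeilType A φ 3 d → WeilAlgebraicFor 3 d A φ)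
    (h₂ : ∀ (d : ℕ) (A : AbelianVariety ℂ) (φ : A ⟶ A), IsWeilType A φ 2 d → WeilAlgebraicFor 2 d A φ) :
    HodgeQuadraticFourfold31CMThreefoldSquaredCarrier := by
  intro Y Z ψ χ d hd hY hYs hY2 hZ hZs hZf hZ6 hψ hχ hsig
  obtain ⟨χ', hχ', hT, hG⟩ := hSG Y Z ψ χ d hd hY hYs hY2 hZ hZs hZf hZ6 hψ hχ hsig
  exact hodgeConjectureFor_prod_prod_of_weilGenerated_of_slices hd hY hZ hψ hχ' hT hG (h₃ d) (h₂ d)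

/-- **By name: the `Y₄(3,1) × Z₃²` carrier cell from `(S+G)_T`, `W₆` (stmt-HodgeConjecture-2524) and F1.** No tenfold
input, no `HC_CM`. [cite: Deligne1982HodgeCycles, §4 Prop. 4.4 and §5 (c)] [cite: Markman2025SurveySecant, Thm. 1.2]
[cite: Schoen1998HodgeWeilAddendum, §10] -/
theorem hodgeQuadraticFourfold31CMThreefoldSquaredCarrier_of_weilGenerated_of_weilSixfolds_of_markmanFourfold
    (hSG : ∀ (Y Z : AbelianVariety ℂ) (ψ : Y ⟶ Y) (χ : Z ⟶ Z) (d : ℕ), 0 < d →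
      Y.dim = 4 → Y.IsSimple → Module.finrank ℚ Y.endAlgebra = 2 →
      Z.dim = 3 → Z.IsSimple → IsField Z.endAlgebra → Module.finrank ℚ Z.endAlgebra = 6 →
      ψ ≫ ψ = -(d • 𝟙 Y) → χ ≫ χ = -(d • 𝟙 Z) →
      (eigenMultiplicity Y ψ (Complex.I * (Real.sqrt d : ℂ)) = 1 ∨
        eigenMultiplicity Y ψ (-(Complex.I * (Real.sqrt d : ℂ))) = 1) →
      ∃ χ' : Z ⟶ Z, χ' ≫ χ' = -(d • 𝟙 Z) ∧
        IsWeilType (Y.prod (Z.prod Z))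
          (AbelianVariety.prodLift (AbelianVariety.fst Y (Z.prod Z) ≫ ψ)
            (AbelianVariety.snd Y (Z.prod Z) ≫
              AbelianVariety.prodLift (AbelianVariety.fst Z Z ≫ χ') (AbelianVariety.snd Z Z ≫ χ'))) 5 d ∧
        IsDivisorWeilGenerated (Y.prod (Z.prod Z))
          (AbelianVariety.prodLift (AbelianVariety.fst Y (Z.prod Z) ≫ ψ)
            (AbelianVariety.snd Y (Z.prod Z) ≫
              AbelianVariety.prodLift (AbelianVariety.fst Z Z ≫ χ') (AbelianVariety.snd Z Z ≫ χ'))) 5 d)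
    (hW₆ : SevenfoldWeilCensus.WeilSixfolds) (hF1 : Markman2025_weilClasses_algebraic_abelianFourfold) :
    HodgeQuadraticFourfold31CMThreefoldSquaredCarrier :=
  hodgeQuadraticFourfold31CMThreefoldSquaredCarrier_of_weilGenerated_of_slices hSG
    (fun _ _ _ hW ↦ weilAlgebraicFor_three_of_weilSixfolds hW₆ hW)
    (fun _ _ _ hW ↦ weilAlgebraicFor_two_of_markmanFourfold hF1 hW)

end Summit.HodgeConjecture.HodgeConjecture.Ring2.Atlas
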